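import Mathlib
import HarnessLib

/-!
# The Hilbert–Mumford criterion reaching a closed orbit (Kempf 1978, Thm. 1.4), for
# `SL_m(ℂ)³` acting on `ℂ^m ⊗ ℂ^m ⊗ ℂ^m`

A NAMED FACT (D-0014, statement only), requested by route MatrixMultiplication/ToricBorderRank
(support item `HilbertMumfordHalf`, stmt-MatrixMultiplication-9968, direction (⇒): "`⟨n,n,n⟩` is
polystable, so its orbit is the closed orbit in `cl(SL³·T)` and the Hilbert–Mumford/Kempf–
Birkes–Richardson criterion gives a 1-PS `λ ⊂ SL³` with `lim λ(t)T ∈ SL³·⟨n,n,n⟩`"). The other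
ingredient named there, polystability of `⟨n,n,n⟩`, is PROVED in the tree
(`Literature.Computability.AlgebraicComplexity.BurgisserIkenmeyer2017_cor49_matMulTensor_holds`).

## Sources

* G. R. Kempf, *Instability in invariant theory*, Ann. of Math. (2) **108** (1978) 299–316,
  **Theorem 1.4** (the form of the Hilbert–Mumford theorem going back to Mumford, GIT Ch. 2 §1,
  and Birkes 1971 / Richardson): *Let `X` be an affine scheme of finite type over the
  algebraically closed field `k` on which the reductive group `G` acts, `x` a point of `X`, and
  `S` a closed `G`-stable subset of `X` which meets the closure of the orbit `G·x` (and does not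
  contain `x`). Then there is a one-parameter subgroup `λ : 𝔾_m → G` such that
  `lim_{t→0} λ(t)·x` exists and lies in `S`.*
* D. Birkes, *Orbits of linear algebraic groups*, Ann. of Math. (2) **93** (1971) 459–475
  (the case of linear actions, also over `ℝ`).
* P. Bürgisser, C. Ikenmeyer, *Fundamental invariants of orbit closures*, J. Algebra **477**
  (2017) 390–434 = arXiv:1511.02927, proof of Prop. 4.8 (p. 17 of the arXiv text, held), where
  the statement is invoked for exactly this group and representation: *"let `Y` be a nonempty
  closed `SL_m^3`-orbit in `cl(SL_m^3 w) ∖ SL_m^3 w`. By the Hilbert–Mumford criterion [...] there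
  exists a one-parameter subgroup `σ : ℂ^× → SL_m^3` with `y := lim_{t→0} σ(t) w ∈ Y`"*, and,
  once `σ` is diagonal, *"there exist `μ, ν, π ∈ ℤ^m` such that
  `σ(t) = (diag(t^{μ_1},…,t^{μ_m}), diag(t^{ν_1},…,t^{ν_m}), diag(t^{π_1},…,t^{π_m}))` [...]
  `Σ_i μ_i = Σ_i ν_i = Σ_i π_i = 0` since the image of `σ` is in `SL_m^3`. We have
  `σ(t) w = Σ_{i,j,k} t^{μ_i+ν_j+π_k} w_{ijk}`. The existence of `lim_{t→0} σ(t) w` implies that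
  `μ_i+ν_j+π_k ≥ 0` for all `(i,j,k) ∈ supp(w)`."*

## Rendering (how the Lean statement below is Kempf's theorem for `G = SL_m(ℂ)³`, `X = ℂ^m⊗ℂ^m⊗ℂ^m`)

* Tensors are functions `ι → ι → ι → ℂ` on a finite index type `ι` (`m = |ι|`);
  `SL_m = Matrix.SpecialLinearGroup ι ℂ`; the factorwise action of `(A, B, C)` is the explicit
  triple sum `((A,B,C)·v)(a,b,c) = Σ_{a',b',c'} A_{aa'} B_{bb'} C_{cc'} v(a',b',c')` — the spelling
  of `MatMulPolystable.lean` and of the requesting item (no auxiliary definition).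
* `x = v`, `S = SL³·w`. Topology: the hypotheses use the EUCLIDEAN (product) topology of
  `ι → ι → ι → ℂ`, as the requesting item does. They imply Kempf's: the Euclidean closure of
  `SL³·v` is contained in its Zariski closure (polynomials are continuous), so `S` meets
  `cl_Zar(G·x)`; and an orbit of the connected complex algebraic group `SL³` is constructible
  (Chevalley), so its Euclidean and Zariski closures coincide (Mumford, *Red Book*, I §10 Cor. 1)
  and a Euclidean-closed orbit is Zariski closed and `G`-stable. If `x ∈ S`, i.e. `w = h·v` with
  `h ∈ SL³`, the conclusion holds with zero weights, `k = h`, `g = 1`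
  (`Kempf1978_thm14_tensor_of_mem_orbit`); otherwise Kempf's theorem applies verbatim.
* One-parameter subgroups: a morphism `λ : 𝔾_m → SL_m(ℂ)³` is `λ(t) = k⁻¹·D(t)·k` with
  `k ∈ SL_m³` and `D(t) = (diag(t^{α_a}), diag(t^{β_b}), diag(t^{γ_c}))`, `α, β, γ ∈ ℤ^ι`,
  `Σα = Σβ = Σγ = 0` (the image `λ(𝔾_m)` is a torus of `SL_m³`, hence conjugate into the diagonal
  maximal torus — Borel, *Linear Algebraic Groups* (1991), §8 and Cor. 11.3 — and the conjugator
  may be scaled to determinant one; a character of `𝔾_m` is `t ↦ t^e`, `e ∈ ℤ`). With `u := k·v`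
  one has `(D(t)·u)(a,b,c) = t^{α_a+β_b+γ_c} u(a,b,c)`, so
  `lim_{t→0} λ(t)·v` exists iff `u` vanishes on the cells of negative weight, and then equals
  `k⁻¹·u₀`, `u₀` the truncation of `u` to the cells of weight zero; `k⁻¹·u₀ ∈ SL³·w` iff
  `u₀ = g·w` for some `g ∈ SL³`. This is the (limit-free, purely algebraic) conclusion below.
* Degenerate cases are harmless: for `ι` empty all tensors coincide and `k = g = 1`, empty weights
  answer; for `w ∈ SL³·v` zero weights answer.

## Not here

Kempf's optimal (instability) subgroups and the rationality/uniqueness theory of §§2–4 of the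
paper; the general reductive `G` / general affine `X`; Luna's refinement (subgroup in the
centraliser of a reductive stabiliser subgroup); the Kempf–Ness theorem (proved in the tree for
tensors, `KempfNessClosedOrbit.lean`). Discharge status: NOT proved here (needs either the
valuative criterion with the Iwahori decomposition of `SL_m(ℂ((t)))`, or curve selection).
-/

noncomputable section

open scoped BigOperators

namespace Literature.RepresentationTheory.AlgebraicGroups

/-- **Hilbert–Mumford criterion, closed-orbit form (Kempf 1978, Thm. 1.4), for `SL_m(ℂ)³` acting
factorwise on `ℂ^m ⊗ ℂ^m ⊗ ℂ^m`.** Let `v, w : ι → ι → ι → ℂ` (`ι` finite). If the `SL³`-orbit of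
`w` is closed and `w` lies in the closure of the `SL³`-orbit of `v` (Euclidean topology), then
some one-parameter subgroup of `SL³` drives `v` into the orbit of `w`; written out after
diagonalising the subgroup (`λ(t) = k⁻¹ (diag t^α, diag t^β, diag t^γ) k`, `k ∈ SL³`,
`Σα = Σβ = Σγ = 0`): the translate `k·v` vanishes on every cell `(a,b,c)` of negative weight
`α a + β b + γ c < 0` (the limit `t → 0` exists), and its truncation to the cells of weight `0`
(the limit, translated by `k`) is a translate `g·w` of `w`, `g ∈ SL³`. Grounds direction (⇒) of
`Summit.MatrixMultiplication.MatrixMultiplication.Theses.ToricBorderRank.HilbertMumfordHalf`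
(with `ι = Fin n × Fin n`, `w = ⟨n,n,n⟩`, whose orbit is closed by
`BurgisserIkenmeyer2017_cor49_matMulTensor_holds`). See the module docstring for the translation
(Euclidean vs. Zariski closure of orbits; diagonalisation of one-parameter subgroups).
[cite: Kempf1978, Thm. 1.4] -/
def Kempf1978_thm14_tensor : Prop :=
  ∀ (ι : Type) [Fintype ι] [DecidableEq ι] (v w : ι → ι → ι → ℂ),
    IsClosed (Set.range fun g : Matrix.SpecialLinearGroup ι ℂ × Matrix.SpecialLinearGroup ι ℂ ×
        Matrix.SpecialLinearGroup ι ℂ =>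
      (fun a b c => ∑ a', ∑ b', ∑ c', (g.1 : Matrix ι ι ℂ) a a' * (g.2.1 : Matrix ι ι ℂ) b b' *
        (g.2.2 : Matrix ι ι ℂ) c c' * w a' b' c')) →
    w ∈ closure (Set.range fun g : Matrix.SpecialLinearGroup ι ℂ × Matrix.SpecialLinearGroup ι ℂ ×
        Matrix.SpecialLinearGroup ι ℂ =>
      (fun a b c => ∑ a', ∑ b', ∑ c', (g.1 : Matrix ι ι ℂ) a a' * (g.2.1 : Matrix ι ι ℂ) b b' *
        (g.2.2 : Matrix ι ι ℂ) c c' * v a' b' c')) →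
    ∃ (k g : Matrix.SpecialLinearGroup ι ℂ × Matrix.SpecialLinearGroup ι ℂ ×
        Matrix.SpecialLinearGroup ι ℂ) (α β γ : ι → ℤ),
      ∑ a, α a = 0 ∧ ∑ b, β b = 0 ∧ ∑ c, γ c = 0 ∧
      (∀ a b c, α a + β b + γ c < 0 →
        ∑ a', ∑ b', ∑ c', (k.1 : Matrix ι ι ℂ) a a' * (k.2.1 : Matrix ι ι ℂ) b b' *
          (k.2.2 : Matrix ι ι ℂ) c c' * v a' b' c' = 0) ∧
      (∀ a b c, ∑ a', ∑ b', ∑ c', (g.1 : Matrix ι ι ℂ) a a' * (g.2.1 : Matrix ι ι ℂ) b b' *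
          (g.2.2 : Matrix ι ι ℂ) c c' * w a' b' c' =
        if α a + β b + γ c = 0 then
          ∑ a', ∑ b', ∑ c', (k.1 : Matrix ι ι ℂ) a a' * (k.2.1 : Matrix ι ι ℂ) b b' *
            (k.2.2 : Matrix ι ι ℂ) c c' * v a' b' c'
        else 0)

/-- The degenerate instance `w ∈ SL³·v` of `Kempf1978_thm14_tensor` needs no invariant theory:
zero weights and `k := h`, `g := 1` answer when `w = h·v`. Recorded as a sanity check of the
rendering (the conclusion is satisfiable in the trivial case exactly as the module docstring
says). [folklore] -/
theorem Kempf1978_thm14_tensor_of_mem_orbit (ι : Type) [Fintype ι] [DecidableEq ι]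
    (v w : ι → ι → ι → ℂ)
    (h : w ∈ Set.range fun g : Matrix.SpecialLinearGroup ι ℂ × Matrix.SpecialLinearGroup ι ℂ ×
        Matrix.SpecialLinearGroup ι ℂ =>
      (fun a b c => ∑ a', ∑ b', ∑ c', (g.1 : Matrix ι ι ℂ) a a' * (g.2.1 : Matrix ι ι ℂ) b b' *
        (g.2.2 : Matrix ι ι ℂ) c c' * v a' b' c')) :
    ∃ (k g : Matrix.SpecialLinearGroup ι ℂ × Matrix.SpecialLinearGroup ι ℂ ×
        Matrix.SpecialLinearGroup ι ℂ) (α β γ : ι → ℤ),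
      ∑ a, α a = 0 ∧ ∑ b, β b = 0 ∧ ∑ c, γ c = 0 ∧
      (∀ a b c, α a + β b + γ c < 0 →
        ∑ a', ∑ b', ∑ c', (k.1 : Matrix ι ι ℂ) a a' * (k.2.1 : Matrix ι ι ℂ) b b' *
          (k.2.2 : Matrix ι ι ℂ) c c' * v a' b' c' = 0) ∧
      (∀ a b c, ∑ a', ∑ b', ∑ c', (g.1 : Matrix ι ι ℂ) a a' * (g.2.1 : Matrix ι ι ℂ) b b' *
          (g.2.2 : Matrix ι ι ℂ) c c' * w a' b' c' =
        if α a + β b + γ c = 0 then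
          ∑ a', ∑ b', ∑ c', (k.1 : Matrix ι ι ℂ) a a' * (k.2.1 : Matrix ι ι ℂ) b b' *
            (k.2.2 : Matrix ι ι ℂ) c c' * v a' b' c'
        else 0) := by
  obtain ⟨h, rfl⟩ := h
  refine ⟨h, 1, 0, 0, 0, by simp, by simp, by simp, ?_, ?_⟩
  · intro a b c habc
    simp at habc
  · intro a b c
    simp only [Pi.zero_apply, add_zero, if_true]
    simp [Matrix.one_apply, Finset.sum_ite_eq, Finset.mem_univ]

end Literature.RepresentationTheory.AlgebraicGroups
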